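import Summits.AtomisticToContinuum.HydrodynamicLimit.Theorems.TwoClocksEquilibriumFastWindowLDStubOneSiteGauss
import Summits.AtomisticToContinuum.HydrodynamicLimit.Theorems.TwoClocksEquilibriumFastWindowLDStubStaticReduction
import Summits.AtomisticToContinuum.HydrodynamicLimit.Theorems.OneFlightGossipEngineKineticCurrentsWindowLDUniformLedgerAssemblyDuality
import Summits.AtomisticToContinuum.HydrodynamicLimit.Theorems.OneFlightGossipEngineKineticCurrentsWindowLDApriori
import Literature.MathematicalPhysics.KineticTheory.HardSphereTwoTimePressure
import Literature.Analysis.FluidPDE.HardSphereFlowJointMeasurable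

/-!
# Stub `stub_tiltDuality` of the line `Sketch` for the crux `TwoClocks.EquilibriumFastWindowLD`
(stmt-AtomisticToContinuum-14440, skeleton rev 5)

The Gibbs–entropy duality step of the line: the PERTURBATIVE ENTROPY FORM of the crux
(for every probability law `Q ≪ G_N` of relative entropy `H(Q | G_N) ≤ s₀ (N+1)`,
`β₁ · E_Q[S] ≤ H(Q | G_N) + ε (N+1)`, with `S = S^G_{N,τ}(z) := Σᵢ w⁻¹∫₀ʷ G((Φ_N.flow r z)ᵢ) dr`,
`w = τ (N+1)^{-1/3}`, `G_N := localGibbsLaw σ a₀ u₀ θ₀ N Φ_N` the homogeneous Gibbs law) implies the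
crux restricted to the bounded class `𝒢(C')` (continuous `G`, `|G(x,v)| ≤ C'(1+|v|²)`, compact
`v`-support, `M_{1,u₀,θ₀}`-orthogonal at every `x` to `1, v_j, |v|²`) with a class-uniform tilt
range: `∫ e^{β S} dG_N ≤ e^{ε (N+1)}` eventually in `N`, for `|β| ≤ β₁'`.

Proof (pure measure theory, no dynamics beyond the landed statics):

* `lintegral_exp_le_of_entropyLinear` — the abstract duality on a probability space: tilt `μ` by
  `β S` (`Q* := μ.tilted (β S)`); the Gibbs variational identity
  `H(Q* | μ) = β E_{Q*} S − log Z` (`LedgerAssembly.klDiv_tilted_eq`); the Donsker–Varadhan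
  bound at a static tilt `t₀` with `∫ e^{t₀ S} dμ ≤ e^A`
  (`LedgerAssembly.integral_le_of_exp_moment`) gives `E_{Q*} S ≤ (H + A)/t₀`, whence for
  `β ≤ t₀/2` and `2βA ≤ s t₀` the entropy self-bound `H(Q* | μ) ≤ s`; so the entropy-linear
  hypothesis applies to `Q*` and yields `log Z ≤ e`.
* `windowLD_of_pos` — the instance for `0 < β ≤ β₁'`: `S` is bounded and a.e.-measurable under
  `G_N` (`HardSphereFlow.aemeasurable_intervalIntegral_comp_flow_torus`), the static window bound at
  tilt `t₀` is `stub_staticReduction` fed with the one-site Gaussian bound `stub_oneSiteGauss`.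
* `stub_tiltDuality` — bookkeeping: `σ₀' := min σ₀ (1/2)`,
  `β₁' := min β₁ (min (t₀/2) (s₀/(2Kt₀+1)))`; `β = 0` is trivial and `β < 0` is the positive case
  for `−G ∈ 𝒢(C')` (`S^{−G} = −S^{G}`).

References: C. Kipnis, C. Landim, *Scaling Limits of Interacting Particle Systems* (1999), App. 1 §8
(entropy inequality and the variational formula for the relative entropy).
-/

noncomputable section

open MeasureTheory ProbabilityTheory Real Set Filter InformationTheory
open scoped ENNReal BigOperators

namespace Summit.AtomisticToContinuum.HydrodynamicLimit.Theorems.FastWindowRG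

open Literature.Analysis.FluidPDE Literature.MathematicalPhysics.KineticTheory

/-! ### The abstract duality step on a probability space -/

open Summit.AtomisticToContinuum.HydrodynamicLimit.Theorems.KineticCurrentsWindowLDUniformGossip in
/-- **Abstract Gibbs–entropy duality.** Let `μ` be a probability measure and `S` a bounded
a.e.-strongly-measurable observable with the static exponential bound `∫⁻ e^{t₀ S} dμ ≤ e^A`
(`t₀ > 0`). Suppose the ENTROPY-LINEAR bound `β₁ ∫ S dQ ≤ H(Q | μ) + e` holds for every probability
law `Q ≪ μ` with `H(Q | μ) ≤ s`. Then for every tilt `0 < β ≤ β₁` with `β ≤ t₀ / 2` and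
`2 β A ≤ s t₀`: `∫⁻ e^{β S} dμ ≤ e^{e}` (`e ≥ 0`). Proof: the tilted law `Q* = μ.tilted (β S)` has
`H(Q* | μ) = β ∫ S dQ* − log ∫ e^{βS} dμ` (Gibbs variational identity) and, by the Donsker–Varadhan
bound at tilt `t₀`, `∫ S dQ* ≤ (H(Q* | μ) + A) / t₀`; hence `H(Q* | μ) ≤ s` whenever the log-moment
is positive, and the entropy-linear bound at `Q*` closes. -/
private theorem lintegral_exp_le_of_entropyLinear {Ω : Type*} [MeasurableSpace Ω]
    {μ : Measure Ω} [IsProbabilityMeasure μ] {S : Ω → ℝ} (hSm : AEStronglyMeasurable S μ)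
    {B : ℝ} (hSB : ∀ z, |S z| ≤ B) {β β₁ t₀ A s e : ℝ} (hβ : 0 < β) (hββ₁ : β ≤ β₁)
    (ht₀ : 0 < t₀) (hβt : β ≤ t₀ / 2) (hA : 2 * β * A ≤ s * t₀) (he : 0 ≤ e)
    (hstat : ∫⁻ z, ENNReal.ofReal (Real.exp (t₀ * S z)) ∂μ ≤ ENNReal.ofReal (Real.exp A))
    (hP : ∀ Q : Measure Ω, IsProbabilityMeasure Q → Q ≪ μ → klDiv Q μ ≤ ENNReal.ofReal s →
      β₁ * ∫ z, S z ∂Q ≤ (klDiv Q μ).toReal + e) :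
    ∫⁻ z, ENNReal.ofReal (Real.exp (β * S z)) ∂μ ≤ ENNReal.ofReal (Real.exp e) := by
  -- the tilt density is bounded, hence integrable
  have hexp : Integrable (fun z => Real.exp (β * S z)) μ := by
    refine Integrable.of_bound (Real.continuous_exp.comp_aestronglyMeasurable (hSm.const_mul β))
      (Real.exp (β * B)) (ae_of_all _ fun z => ?_)
    rw [Real.norm_eq_abs, abs_of_pos (Real.exp_pos _), Real.exp_le_exp]
    exact mul_le_mul_of_nonneg_left ((le_abs_self _).trans (hSB z)) hβ.le
  have hZpos : 0 < ∫ z, Real.exp (β * S z) ∂μ := integral_exp_pos hexp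
  -- it suffices to bound the log-moment
  suffices hLe : Real.log (∫ z, Real.exp (β * S z) ∂μ) ≤ e by
    rw [← ofReal_integral_eq_lintegral_ofReal hexp (ae_of_all _ fun _ => (Real.exp_pos _).le)]
    refine ENNReal.ofReal_le_ofReal ?_
    rw [← Real.exp_log hZpos]
    exact Real.exp_le_exp.2 hLe
  -- the tilted law `Q* = μ.tilted (β S)`
  haveI : IsProbabilityMeasure (μ.tilted fun z => β * S z) := isProbabilityMeasure_tilted hexp
  have hQac : (μ.tilted fun z => β * S z) ≪ μ := tilted_absolutelyContinuous μ _
  have hSQ : Integrable S (μ.tilted fun z => β * S z) :=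
    Integrable.of_bound (hSm.mono_ac hQac) B
      (ae_of_all _ fun z => by rw [Real.norm_eq_abs]; exact hSB z)
  -- Gibbs variational identity
  obtain ⟨hfin, hGibbs⟩ := LedgerAssembly.klDiv_tilted_eq hexp (hSQ.const_mul β)
  rw [integral_const_mul] at hGibbs
  have h0 : 0 ≤ (klDiv (μ.tilted fun z => β * S z) μ).toReal := ENNReal.toReal_nonneg
  rcases le_or_gt (Real.log (∫ z, Real.exp (β * S z) ∂μ)) 0 with hL0 | hL0
  · exact hL0.trans he
  -- Donsker–Varadhan at the static tilt `t₀`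
  obtain ⟨hexp₀, hle₀⟩ := LedgerAssembly.integrable_exp_of_lintegral_le (hSm.const_mul t₀) hstat
  have hm := LedgerAssembly.integral_le_of_exp_moment hfin hSQ ht₀ hexp₀ hle₀
  rw [le_div_iff₀ ht₀] at hm
  -- the entropy self-bound of the tilted law
  have hs : (klDiv (μ.tilted fun z => β * S z) μ).toReal ≤ s := by
    have h1 : (klDiv (μ.tilted fun z => β * S z) μ).toReal <
        β * ∫ z, S z ∂(μ.tilted fun z => β * S z) := by linarith
    have h2 := mul_lt_mul_of_pos_right h1 ht₀
    have h3 := mul_le_mul_of_nonneg_left hm hβ.le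
    have h4 := mul_le_mul_of_nonneg_right hβt h0
    have h5 : (klDiv (μ.tilted fun z => β * S z) μ).toReal * t₀ < s * t₀ := by nlinarith
    exact (lt_of_mul_lt_mul_right h5 ht₀.le).le
  have hkl : klDiv (μ.tilted fun z => β * S z) μ ≤ ENNReal.ofReal s := by
    rw [← ENNReal.ofReal_toReal hfin]
    exact ENNReal.ofReal_le_ofReal hs
  -- the entropy-linear bound at the tilted law
  have hPQ := hP _ inferInstance hQac hkl
  rcases le_or_gt (∫ z, S z ∂(μ.tilted fun z => β * S z)) 0 with hm0 | hm0
  · nlinarith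
  · nlinarith

/-! ### The positive-tilt instance under the homogeneous Gibbs law -/

/-- **The bounded-class window LD bound at positive tilts** from the perturbative entropy form.
Under the homogeneous Gibbs law `G_N` (`a₀, θ₀ > 0`, `σ ≤ 1/2`), for a continuous BOUNDED
one-body observable `G` with the one-site Gaussian bound
`∫⁻ e^{t₀ G(x,·)} dN(u₀, θ₀ id) ≤ e^{K t₀²}` at every `x` (so that `stub_staticReduction` gives the
static window bound `∫⁻ e^{t₀ S} dG_N ≤ e^{K t₀² (N+1)}`), the entropy-linear hypothesis for `G`
with constants `β₁, s₀` yields, for every `0 < β ≤ β₁` with `β ≤ t₀/2`, `2βKt₀ ≤ s₀` and every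
`ε > 0`, a window `τ > 0` with `∫⁻ e^{β S^G_{N,τ}} dG_N ≤ e^{ε (N+1)}` for all large `N`
(`lintegral_exp_le_of_entropyLinear` with `A = K t₀² (N+1)`, `s = s₀ (N+1)`, `e = ε (N+1)`). -/
private theorem windowLD_of_pos {a₀ θ₀ : ℝ} (ha : 0 < a₀) (hθ : 0 < θ₀) (u₀ : V3) {σ : ℝ}
    (hσ2 : σ ≤ 1 / 2)
    (Φ : (N : ℕ) → HardSphereFlow (Torus.geometry (Fin 3)) (hsDiameter σ N) (N + 1))
    {G : T3 × V3 → ℝ} (hG : Continuous G) {M : ℝ} (hGM : ∀ y, |G y| ≤ M)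
    {t₀ K : ℝ} (ht₀ : 0 < t₀)
    (hone : ∀ x : T3, ∫⁻ v, ENNReal.ofReal (Real.exp (t₀ * G (x, v))) ∂(gaussMeasure u₀ θ₀) ≤
      ENNReal.ofReal (Real.exp (K * t₀ ^ 2)))
    {β₁ s₀ : ℝ}
    (hPG : ∀ ε : ℝ, 0 < ε → ∃ τ : ℝ, 0 < τ ∧ ∃ N₀ : ℕ, ∀ N : ℕ, N₀ ≤ N →
        ∀ Q : Measure (Config (N + 1) (Fin 3) T3), IsProbabilityMeasure Q →
          Q ≪ localGibbsLaw σ (fun _ => a₀) (fun _ => u₀) (fun _ => θ₀) N (Φ N) →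
          klDiv Q (localGibbsLaw σ (fun _ => a₀) (fun _ => u₀) (fun _ => θ₀) N (Φ N)) ≤
            ENNReal.ofReal (s₀ * ((N : ℝ) + 1)) →
          β₁ * ∫ z, (∑ i : Fin (N + 1), (τ * ((N : ℝ) + 1) ^ (-(1 / 3 : ℝ)))⁻¹ *
              ∫ r in (0 : ℝ)..(τ * ((N : ℝ) + 1) ^ (-(1 / 3 : ℝ))), G (((Φ N).flow r z) i)) ∂Q ≤
            (klDiv Q (localGibbsLaw σ (fun _ => a₀) (fun _ => u₀) (fun _ => θ₀) N (Φ N))).toReal +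
              ε * ((N : ℝ) + 1))
    {β : ℝ} (hβ : 0 < β) (hββ₁ : β ≤ β₁) (hβt : β ≤ t₀ / 2) (hβs : 2 * β * K * t₀ ≤ s₀)
    {ε : ℝ} (hε : 0 < ε) :
    ∃ τ : ℝ, 0 < τ ∧ ∃ N₀ : ℕ, ∀ N : ℕ, N₀ ≤ N →
      ∫⁻ z, ENNReal.ofReal (Real.exp (β * ∑ i : Fin (N + 1),
          (τ * ((N : ℝ) + 1) ^ (-(1 / 3 : ℝ)))⁻¹ *
            ∫ r in (0 : ℝ)..(τ * ((N : ℝ) + 1) ^ (-(1 / 3 : ℝ))), G (((Φ N).flow r z) i)))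
        ∂(localGibbsLaw σ (fun _ => a₀) (fun _ => u₀) (fun _ => θ₀) N (Φ N)) ≤
        ENNReal.ofReal (Real.exp (ε * ((N : ℝ) + 1))) := by
  obtain ⟨τ, hτ, N₀, hN₀⟩ := hPG ε hε
  refine ⟨τ, hτ, N₀, fun N hN => ?_⟩
  set μ := localGibbsLaw σ (fun _ => a₀) (fun _ => u₀) (fun _ => θ₀) N (Φ N)
  haveI : IsProbabilityMeasure μ := isProbabilityMeasure_localGibbsLaw (a₀ := fun _ => a₀)
    (θ₀ := fun _ => θ₀) (u₀ := fun _ => u₀) continuous_const continuous_const continuous_const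
    (fun _ => ha) (fun _ => hθ) hσ2 N (Φ N)
  set w : ℝ := τ * ((N : ℝ) + 1) ^ (-(1 / 3 : ℝ))
  have hw : 0 < w := mul_pos hτ (Real.rpow_pos_of_pos (by positivity) _)
  set S : Config (N + 1) (Fin 3) T3 → ℝ :=
    fun z => ∑ i : Fin (N + 1), w⁻¹ * ∫ r in (0 : ℝ)..w, G (((Φ N).flow r z) i)
  -- `S` is a.e.-measurable under `G_N` (the law is carried by the good set)
  have hgood : μ (Φ N).goodᶜ = 0 :=
    (localGibbsLaw_absolutelyContinuous σ _ _ _ N (Φ N)) (Φ N).measure_compl_good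
  have hSm : AEStronglyMeasurable S μ := by
    refine (Finset.aemeasurable_fun_sum _ fun i _ => ?_).aestronglyMeasurable
    exact ((Φ N).aemeasurable_intervalIntegral_comp_flow_torus
      (hG.measurable.comp (measurable_pi_apply i)) 0 w hgood).const_mul _
  -- `S` is bounded by `(N+1) M`
  have hSB : ∀ z, |S z| ≤ ((N : ℝ) + 1) * M := fun z => by
    have hterm : ∀ i : Fin (N + 1), |w⁻¹ * ∫ r in (0 : ℝ)..w, G (((Φ N).flow r z) i)| ≤ M := by
      intro i
      have hint : ‖∫ r in (0 : ℝ)..w, G (((Φ N).flow r z) i)‖ ≤ M * |w - 0| :=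
        intervalIntegral.norm_integral_le_of_norm_le_const fun r _ => by
          rw [Real.norm_eq_abs]
          exact hGM _
      rw [Real.norm_eq_abs, sub_zero, abs_of_pos hw] at hint
      rw [abs_mul, abs_of_pos (inv_pos.2 hw)]
      calc w⁻¹ * |∫ r in (0 : ℝ)..w, G (((Φ N).flow r z) i)| ≤ w⁻¹ * (M * w) :=
            mul_le_mul_of_nonneg_left hint (inv_pos.2 hw).le
        _ = M := by rw [mul_comm, mul_assoc, mul_inv_cancel₀ hw.ne', mul_one]
    calc |S z| ≤ ∑ i, |w⁻¹ * ∫ r in (0 : ℝ)..w, G (((Φ N).flow r z) i)| :=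
          Finset.abs_sum_le_sum_abs _ _
      _ ≤ ∑ _i : Fin (N + 1), M := Finset.sum_le_sum fun i _ => hterm i
      _ = ((N : ℝ) + 1) * M := by
          rw [Finset.sum_const, Finset.card_univ, Fintype.card_fin, nsmul_eq_mul]
          push_cast
          ring
  -- the static window bound at tilt `t₀`
  have hstat : ∫⁻ z, ENNReal.ofReal (Real.exp (t₀ * S z)) ∂μ ≤
      ENNReal.ofReal (Real.exp (K * t₀ ^ 2 * ((N : ℝ) + 1))) :=
    stub_staticReduction ha hθ u₀ hσ2 N (Φ N) hG hone hτ
  -- the entropy-linear bound at this `N`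
  have hP : ∀ Q : Measure (Config (N + 1) (Fin 3) T3), IsProbabilityMeasure Q → Q ≪ μ →
      klDiv Q μ ≤ ENNReal.ofReal (s₀ * ((N : ℝ) + 1)) →
      β₁ * ∫ z, S z ∂Q ≤ (klDiv Q μ).toReal + ε * ((N : ℝ) + 1) := hN₀ N hN
  have hA : 2 * β * (K * t₀ ^ 2 * ((N : ℝ) + 1)) ≤ s₀ * ((N : ℝ) + 1) * t₀ := by
    have hN1 : (0 : ℝ) ≤ t₀ * ((N : ℝ) + 1) := by positivity
    nlinarith [mul_le_mul_of_nonneg_right hβs hN1]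
  exact lintegral_exp_le_of_entropyLinear hSm hSB hβ hββ₁ ht₀ hβt hA (by positivity) hstat hP

/-! ### The registered stub -/

/-- **`stub_tiltDuality`** (Gibbs variational principle at the tilt + the entropy self-bound of
the tilted law from the landed static window MGF). The perturbative entropy-linear relaxation
bound implies the crux restricted to the bounded class `𝒢(C')` with a class-uniform tilt range
(= `stub_boundedWindowLD` of skeleton rev 4, the hypothesis of the landed
`EquilibriumFastWindowLD_of_boundedWindowLD`). Constants: `σ₀' := min σ₀ (1/2)`,
`β₁' := min β₁ (min (t₀/2) (s₀/(2Kt₀+1)))` with `t₀, K` the class-uniform one-site constants of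
`stub_oneSiteGauss`; `β > 0` is `windowLD_of_pos` for `G`, `β < 0` is `windowLD_of_pos` for
`−G ∈ 𝒢(C')` at tilt `−β` (`S^{−G} = −S^{G}`), `β = 0` is trivial. -/
theorem stub_tiltDuality :
    (∃ σ₀ : ℝ, 0 < σ₀ ∧ ∀ (a₀ θ₀ : ℝ) (u₀ : V3), 0 < a₀ → 0 < θ₀ → ∀ σ : ℝ, 0 < σ → σ < σ₀ →
      ∀ Φ : (N : ℕ) → HardSphereFlow (Torus.geometry (Fin 3)) (hsDiameter σ N) (N + 1),
      ∀ C' : ℝ, 0 ≤ C' → ∃ β₁ : ℝ, 0 < β₁ ∧ ∃ s₀ : ℝ, 0 < s₀ ∧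
      ∀ G : T3 × V3 → ℝ, Continuous G → (∀ y, |G y| ≤ C' * (1 + ‖y.2‖ ^ 2)) →
      (∃ R : ℝ, ∀ y : T3 × V3, R ≤ ‖y.2‖ → G y = 0) →
      (∀ x, ∫ v, G (x, v) * localMaxwellian 1 θ₀ u₀ v = 0) →
      (∀ x (j : Fin 3), ∫ v, G (x, v) * v j * localMaxwellian 1 θ₀ u₀ v = 0) →
      (∀ x, ∫ v, G (x, v) * ‖v‖ ^ 2 * localMaxwellian 1 θ₀ u₀ v = 0) →
      ∀ ε : ℝ, 0 < ε → ∃ τ : ℝ, 0 < τ ∧ ∃ N₀ : ℕ, ∀ N : ℕ, N₀ ≤ N →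
        ∀ Q : Measure (Config (N + 1) (Fin 3) T3), IsProbabilityMeasure Q →
          Q ≪ localGibbsLaw σ (fun _ => a₀) (fun _ => u₀) (fun _ => θ₀) N (Φ N) →
          klDiv Q (localGibbsLaw σ (fun _ => a₀) (fun _ => u₀) (fun _ => θ₀) N (Φ N)) ≤
            ENNReal.ofReal (s₀ * ((N : ℝ) + 1)) →
          β₁ * ∫ z, (∑ i : Fin (N + 1), (τ * ((N : ℝ) + 1) ^ (-(1 / 3 : ℝ)))⁻¹ *
              ∫ r in (0 : ℝ)..(τ * ((N : ℝ) + 1) ^ (-(1 / 3 : ℝ))), G (((Φ N).flow r z) i)) ∂Q ≤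
            (klDiv Q (localGibbsLaw σ (fun _ => a₀) (fun _ => u₀) (fun _ => θ₀) N (Φ N))).toReal +
              ε * ((N : ℝ) + 1)) →
    (∃ σ₀ : ℝ, 0 < σ₀ ∧ ∀ (a₀ θ₀ : ℝ) (u₀ : V3), 0 < a₀ → 0 < θ₀ → ∀ σ : ℝ, 0 < σ → σ < σ₀ →
      ∀ Φ : (N : ℕ) → HardSphereFlow (Torus.geometry (Fin 3)) (hsDiameter σ N) (N + 1),
      ∀ C' : ℝ, 0 ≤ C' → ∃ β₁ : ℝ, 0 < β₁ ∧
      ∀ G : T3 × V3 → ℝ, Continuous G → (∀ y, |G y| ≤ C' * (1 + ‖y.2‖ ^ 2)) →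
      (∃ R : ℝ, ∀ y : T3 × V3, R ≤ ‖y.2‖ → G y = 0) →
      (∀ x, ∫ v, G (x, v) * localMaxwellian 1 θ₀ u₀ v = 0) →
      (∀ x (j : Fin 3), ∫ v, G (x, v) * v j * localMaxwellian 1 θ₀ u₀ v = 0) →
      (∀ x, ∫ v, G (x, v) * ‖v‖ ^ 2 * localMaxwellian 1 θ₀ u₀ v = 0) →
      ∀ β : ℝ, |β| ≤ β₁ → ∀ ε : ℝ, 0 < ε → ∃ τ : ℝ, 0 < τ ∧ ∃ N₀ : ℕ, ∀ N : ℕ, N₀ ≤ N →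
        ∫⁻ z, ENNReal.ofReal (Real.exp (β * ∑ i : Fin (N + 1),
            (τ * ((N : ℝ) + 1) ^ (-(1 / 3 : ℝ)))⁻¹ *
              ∫ r in (0 : ℝ)..(τ * ((N : ℝ) + 1) ^ (-(1 / 3 : ℝ))), G (((Φ N).flow r z) i)))
          ∂(localGibbsLaw σ (fun _ => a₀) (fun _ => u₀) (fun _ => θ₀) N (Φ N)) ≤
          ENNReal.ofReal (Real.exp (ε * ((N : ℝ) + 1)))) := by
  rintro ⟨σ₀, hσ₀, hP⟩
  refine ⟨min σ₀ (1 / 2), lt_min hσ₀ (by norm_num), ?_⟩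
  intro a₀ θ₀ u₀ ha hθ σ hσ hσ' Φ C' hC'
  have hσ1 : σ < σ₀ := hσ'.trans_le (min_le_left _ _)
  have hσ2 : σ ≤ 1 / 2 := (hσ'.trans_le (min_le_right _ _)).le
  obtain ⟨β₁, hβ₁, s₀, hs₀, hPG⟩ := hP a₀ θ₀ u₀ ha hθ σ hσ hσ1 Φ C' hC'
  obtain ⟨t₀, ht₀, K, hK, hone⟩ := stub_oneSiteGauss hθ u₀ hC'
  have hKt : 0 < 2 * K * t₀ + 1 := by positivity
  refine ⟨min β₁ (min (t₀ / 2) (s₀ / (2 * K * t₀ + 1))),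
    lt_min hβ₁ (lt_min (by positivity) (div_pos hs₀ hKt)), ?_⟩
  intro G hG hGC hGR h1 hv h2 β hβ ε hε
  -- the tilt range
  have hb1 : |β| ≤ β₁ := hβ.trans (min_le_left _ _)
  have hb2 : |β| ≤ t₀ / 2 := hβ.trans ((min_le_right _ _).trans (min_le_left _ _))
  have hb3 : 2 * |β| * K * t₀ ≤ s₀ := by
    have h := hβ.trans ((min_le_right _ _).trans (min_le_right _ _))
    rw [le_div_iff₀ hKt] at h
    nlinarith [abs_nonneg β, mul_nonneg hK ht₀.le]
  -- `G` is bounded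
  obtain ⟨R, hR⟩ := hGR
  have hGM : ∀ y, |G y| ≤ C' * (1 + R ^ 2) := fun y => by
    rcases le_or_gt R ‖y.2‖ with hy | hy
    · rw [hR y hy, abs_zero]
      positivity
    · refine (hGC y).trans (mul_le_mul_of_nonneg_left ?_ hC')
      nlinarith [norm_nonneg y.2]
  -- the Gibbs law is a probability measure
  have hprob : ∀ N : ℕ,
      IsProbabilityMeasure (localGibbsLaw σ (fun _ => a₀) (fun _ => u₀) (fun _ => θ₀) N (Φ N)) :=
    fun N => isProbabilityMeasure_localGibbsLaw (a₀ := fun _ => a₀) (θ₀ := fun _ => θ₀)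
      (u₀ := fun _ => u₀) continuous_const continuous_const continuous_const
      (fun _ => ha) (fun _ => hθ) hσ2 N (Φ N)
  rcases lt_trichotomy β 0 with hβ0 | rfl | hβ0
  · -- negative tilt: the positive case for `-G ∈ 𝒢(C')` at tilt `-β`
    have hone' : ∀ x : T3, ∫⁻ v, ENNReal.ofReal (Real.exp (t₀ * -G (x, v))) ∂(gaussMeasure u₀ θ₀) ≤
        ENNReal.ofReal (Real.exp (K * t₀ ^ 2)) := fun x =>
      hone (fun v => -G (x, v)) (hG.comp (Continuous.prodMk_right x)).measurable.neg
        (fun v => by simpa only [abs_neg] using hGC (x, v))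
        (by simpa only [neg_mul, integral_neg, neg_eq_zero] using h1 x) t₀ (abs_of_pos ht₀).le
    have hneg := windowLD_of_pos ha hθ u₀ hσ2 Φ (G := fun y => -G y) hG.neg
      (fun y => by simpa only [abs_neg] using hGM y) ht₀ hone'
      (hPG (fun y => -G y) hG.neg (fun y => by simpa only [abs_neg] using hGC y)
        ⟨R, fun y hy => by simp only [hR y hy, neg_zero]⟩
        (fun x => by simpa only [neg_mul, integral_neg, neg_eq_zero] using h1 x)
        (fun x j => by simpa only [neg_mul, integral_neg, neg_eq_zero] using hv x j)
        (fun x => by simpa only [neg_mul, integral_neg, neg_eq_zero] using h2 x))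
      (neg_pos.2 hβ0) (by rwa [abs_of_neg hβ0] at hb1) (by rwa [abs_of_neg hβ0] at hb2)
      (by rwa [abs_of_neg hβ0] at hb3) hε
    obtain ⟨τ, hτ, N₀, hN⟩ := hneg
    refine ⟨τ, hτ, N₀, fun N hN' => ?_⟩
    have h := hN N hN'
    simpa only [intervalIntegral.integral_neg, mul_neg, Finset.sum_neg_distrib, neg_mul,
      neg_neg] using h
  · -- zero tilt
    refine ⟨1, one_pos, 0, fun N _ => ?_⟩
    haveI := hprob N
    simp only [zero_mul, Real.exp_zero, ENNReal.ofReal_one, lintegral_const, measure_univ, mul_one]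
    exact ENNReal.one_le_ofReal.2 (Real.one_le_exp (by positivity))
  · -- positive tilt
    have hone' : ∀ x : T3, ∫⁻ v, ENNReal.ofReal (Real.exp (t₀ * G (x, v))) ∂(gaussMeasure u₀ θ₀) ≤
        ENNReal.ofReal (Real.exp (K * t₀ ^ 2)) := fun x =>
      hone (fun v => G (x, v)) (hG.comp (Continuous.prodMk_right x)).measurable
        (fun v => hGC (x, v)) (h1 x) t₀ (abs_of_pos ht₀).le
    exact windowLD_of_pos ha hθ u₀ hσ2 Φ hG hGM ht₀ hone' (hPG G hG hGC ⟨R, hR⟩ h1 hv h2) hβ0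
      (by rwa [abs_of_pos hβ0] at hb1) (by rwa [abs_of_pos hβ0] at hb2)
      (by rwa [abs_of_pos hβ0] at hb3) hε

end Summit.AtomisticToContinuum.HydrodynamicLimit.Theorems.FastWindowRG

end
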